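import Literature.Analysis.FluidPDE.KNSSThm52Assembly
import Literature.Analysis.FluidPDE.KNSSLiouvillePlanarHolds
import Literature.Analysis.FluidPDE.KNSSTypeIRateLiouvilleDescent
import Literature.Analysis.FluidPDE.AncientMildWeak
import Literature.Analysis.FluidPDE.CurlFreeLiouville
import HarnessLib

/-!
# Stub `stub_fullTranslationLeaf` of the line `Ideator2Sketch` (card `flux-surface-persistence`)
# (crux `IsobaricLinesLiouville`, stmt-NavierStokesRegularity-11741, route `IsobarTomography`)

Liouville for bounded ancient `2½`-dimensional flows: a bounded ancient mild solution of
Navier–Stokes (`ν = 1`, duality form), classical on `(−∞, 0)`, whose velocity is invariant under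
the translations `x ↦ x + δe₁` (Lean coordinate `1`) at every `t < 0`, is constant on every slice.

* The planar trace `(v₀, v₂)(t, (y₀, 0, y₁))` is a bounded weak solution on `ℝ² × (−∞, 0)`
  (`IsBoundedWeakNSSolutionOn.planarTrace_of_lineInvariant`), hence `b(t)` by KNSS 2009, Thm 5.1
  (`KNSS2009_liouville_planar_holds`, `planar_const_of_ae_const`): `v₀(t, ·)`, `v₂(t, ·)` are
  constant.
* KNSS 2009, §4 (`KNSS2009_regularity_boundedWeak_ancient_holds`) writes `v(t) = U(t) + b(t)` at
  a.e. `t` with `U(t, ·)` smooth, all derivatives bounded and Lipschitz in time, and the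
  integrated vorticity equation. Then `∂₁U = 0`, `(DU h)₀ = (DU h)₂ = 0` at every `t < 0`, so
  `ω = curl U = (−∂₂U₁, 0, ∂₀U₁)` has no stretching and `±ω₀`, `±ω₂` solve
  `∂ₜf + (U + b)·∇f = Δf` in the elementary class of KNSS's Lemma 2.1 (`lemma21_data`). Such an
  `f`, being on every slice a directional derivative `∂ₑG` of a function with `|G| ≤ K`, is
  `≤ 0` (`nonpos_of_eq_fderiv_apply`: Lemma 2.1 in half-ball form,
  `KNSS2009_lemma21_halfball_holds`, gives balls `B(y₀, R)` of every radius with `f ≥ sup f / 2`,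
  against `∫_{-R/2}^{R/2} ∂ₑG ≤ 2K` — KNSS's proof of Thm 5.1 with the flux bound replaced by the
  fundamental theorem of calculus on a line). Hence `curl U = 0`, and with `div U = 0` every slice
  `U(t)` is constant (`eq_of_curl_eq_zero_of_isDivFree_of_bounded`); so is `v(t)`, first at a.e.
  `t`, then at every `t < 0` by continuity.

## References

* G. Koch, N. Nadirashvili, G. Seregin, V. Šverák, *Liouville theorems for the Navier–Stokes
  equations and applications*, Acta Math. 203 (2009) 83–105 = arXiv:0709.3599: Lemma 2.1
  (p. 5), §4 (p. 8), Theorems 5.1–5.2 and their proofs (pp. 9–10). [KochNadirashviliSereginSverak2009]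
-/

-- the summit and its single problem share the name (D-0017 nested layout)
set_option linter.dupNamespace false

noncomputable section

namespace Summit.NavierStokesRegularity.NavierStokesRegularity.Theorems.IsobaricLinesLiouville.FluxSurfacePersistence

open scoped InnerProductSpace RealInnerProductSpace ContDiff Laplacian
open Literature.Analysis.FluidPDE Set Function MeasureTheory WithLp InnerProductSpace

/-! ## Lemma 2.1 against the obstruction "`f(t, ·) = ∂ₑG` with `G` bounded" -/
section MaxPrinciple

variable {E : Type*} [NormedAddCommGroup E] [InnerProductSpace ℝ E] [FiniteDimensional ℝ E]

/-- `|Δg(y)| ≤ (dim E) ‖D²g(y)‖` (the Laplacian is the trace of `D²g` in an orthonormal frame).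
[folklore] -/
theorem abs_laplacian_le_finrank_mul (g : E → ℝ) (y : E) :
    |(Δ g) y| ≤ Module.finrank ℝ E * ‖iteratedFDeriv ℝ 2 g y‖ := by
  set b := stdOrthonormalBasis ℝ E with hb
  rw [laplacian_eq_iteratedFDeriv_orthonormalBasis g b]
  have h : ∀ i, |iteratedFDeriv ℝ 2 g y ![b i, b i]| ≤ ‖iteratedFDeriv ℝ 2 g y‖ := fun i => by
    have := (iteratedFDeriv ℝ 2 g y).le_opNorm ![b i, b i]
    rw [Real.norm_eq_abs] at this
    exact this.trans (by simp [Fin.prod_univ_two, b.orthonormal.1 i])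
  calc |∑ i, iteratedFDeriv ℝ 2 g y ![b i, b i]|
      ≤ ∑ i, |iteratedFDeriv ℝ 2 g y ![b i, b i]| := Finset.abs_sum_le_sum_abs _ _
    _ ≤ ∑ _i : Fin (Module.finrank ℝ E), ‖iteratedFDeriv ℝ 2 g y‖ := Finset.sum_le_sum fun i _ => h i
    _ = Module.finrank ℝ E * ‖iteratedFDeriv ℝ 2 g y‖ := by
        rw [Finset.sum_const, Finset.card_univ, Fintype.card_fin, nsmul_eq_mul]

variable [MeasurableSpace E]

/-- **`f ≤ 0` from Lemma 2.1 when every slice of `f` is a directional derivative `∂ₑG` with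
`|G| ≤ K`, `‖e‖ = 1`** (`(f, a)` in the elementary class of `KNSS2009_lemma21_halfball`):
otherwise `M₁ = sup f > 0`, Lemma 2.1 gives a ball `B(y₀, R)`, `R > 4K/M₁`, and a time at which
`f ≥ M₁/2` on it, so `G(y₀ + (R/2)e) − G(y₀ − (R/2)e) ≥ M₁R/2 > 2K` (mean value), absurd. [cite: KochNadirashviliSereginSverak2009, Lemma 2.1 (arXiv p. 5) and proof of Thm 5.1 (p. 9)] -/
theorem nonpos_of_eq_fderiv_apply (hball : KNSS2009_lemma21_halfball E)
    {f : ℝ → E → ℝ} {a : ℝ → E → E} {K : ℝ} {e : E} (he : ‖e‖ = 1)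
    (hcls : Measurable (uncurry a) ∧ (∃ A : ℝ, ∀ t < 0, ∀ y, ‖a t y‖ ≤ A) ∧
      (∃ C : ℝ, ∀ t < 0, ∀ y, |f t y| ≤ C) ∧ (∀ t < 0, ContDiff ℝ 2 (f t)) ∧
      (∃ C : ℝ, ∀ t < 0, ∀ y, ‖fderiv ℝ (f t) y‖ ≤ C ∧ |(Δ (f t)) y| ≤ C) ∧
      ContinuousOn (fun p : ℝ × E => fderiv ℝ (f p.1) p.2) (Iio 0 ×ˢ univ) ∧
      ContinuousOn (fun p : ℝ × E => (Δ (f p.1)) p.2) (Iio 0 ×ˢ univ) ∧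
      ∀ y, ∀ s t : ℝ, s ≤ t → t < 0 →
        f t y - f s y = ∫ τ in s..t, ((Δ (f τ)) y - fderiv ℝ (f τ) y (a τ y)))
    (hrep : ∀ t < 0, ∃ G : E → ℝ, Differentiable ℝ G ∧ (∀ x, |G x| ≤ K) ∧
      ∀ x, f t x = fderiv ℝ G x e) :
    ∀ t < 0, ∀ y, f t y ≤ 0 := by
  obtain ⟨ha, ⟨A, haA⟩, ⟨C, hC⟩, hf2, hfD, hcD, hcΔ, heq⟩ := hcls
  by_contra hcon
  push Not at hcon
  obtain ⟨t₁, ht₁, y₁, hpos⟩ := hcon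
  -- `M₁ = sup f > 0`, approached
  set S : Set ℝ := {r | ∃ t < 0, ∃ y, f t y = r} with hS_def
  have hSb : BddAbove S := ⟨C, fun r ⟨t, ht, y, hr⟩ => hr ▸ (le_abs_self _).trans (hC t ht y)⟩
  have hSne : S.Nonempty := ⟨f t₁ y₁, t₁, ht₁, y₁, rfl⟩
  set M₁ : ℝ := sSup S with hM₁_def
  have hle : ∀ t < 0, ∀ y, f t y ≤ M₁ := fun t ht y => le_csSup hSb ⟨t, ht, y, rfl⟩
  have hM₁pos : 0 < M₁ := hpos.trans_le (hle t₁ ht₁ y₁)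
  have happr : ∀ ε > 0, ∃ t < 0, ∃ y, M₁ - ε < f t y := fun ε hε => by
    obtain ⟨r, ⟨t, ht, y, rfl⟩, hr⟩ := exists_lt_of_lt_csSup hSne (by linarith : M₁ - ε < M₁)
    exact ⟨t, ht, y, hr⟩
  -- a half-ball of radius `R > 4K / M₁` (`K ≥ 0`)
  obtain ⟨G₁, -, hG₁, -⟩ := hrep t₁ ht₁
  have hK0 : 0 ≤ K := (abs_nonneg _).trans (hG₁ y₁)
  set R : ℝ := 4 * K / M₁ + 1 with hR_def
  have hRpos : 0 < R := by positivity
  have hRK : 2 * K < M₁ / 2 * R := by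
    have : M₁ / 2 * R = 2 * K + M₁ / 2 := by rw [hR_def]; field_simp; ring
    rw [this]; linarith
  obtain ⟨y₀, t₀, ht₀, hhalf⟩ :=
    hball ha haA ⟨C, hC⟩ hf2 hfD hcD hcΔ heq hle happr hM₁pos R hRpos
  set t : ℝ := t₀ - R ^ 2 / 2 with ht_def
  have htI : t ∈ Ioo (t₀ - R ^ 2) t₀ := by
    constructor <;> · rw [ht_def]; nlinarith
  obtain ⟨G, hGd, hGK, hfG⟩ := hrep t (htI.2.trans ht₀)
  -- `f(t, ·) = ∂ₑG ≥ M₁ / 2` along the diameter `y₀ + s e`, `|s| < R`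
  set g : ℝ → ℝ := fun s => G (y₀ + s • e) with hg_def
  have hgd : ∀ s, HasDerivAt g (f t (y₀ + s • e)) s := fun s => by
    have hl : HasDerivAt (fun r : ℝ => y₀ + r • e) e s := by
      simpa using ((hasDerivAt_id s).smul_const e).const_add y₀
    have h := (hGd (y₀ + s • e)).hasFDerivAt.comp_hasDerivAt s hl
    rwa [← hfG] at h
  have hge : ∀ s ∈ interior (Ioo (-R) R), M₁ / 2 ≤ deriv g s := fun s hs => by
    rw [isOpen_Ioo.interior_eq] at hs
    rw [(hgd s).deriv]
    refine hhalf t htI _ ?_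
    rw [Metric.mem_ball, dist_eq_norm, add_sub_cancel_left, norm_smul, he, mul_one,
      Real.norm_eq_abs]
    exact abs_lt.2 hs
  have hmvt := (convex_Ioo (-R) R).mul_sub_le_image_sub_of_le_deriv
    (fun s _ => (hgd s).continuousAt.continuousWithinAt)
    (fun s _ => (hgd s).differentiableAt.differentiableWithinAt) hge
    (-(R / 2)) ⟨by linarith, by linarith⟩ (R / 2) ⟨by linarith, by linarith⟩ (by linarith)
  -- … against `|G| ≤ K`
  have ha' := hGK (y₀ + (R / 2) • e)
  have hb' := hGK (y₀ + (-(R / 2)) • e)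
  rw [abs_le] at ha' hb'
  have h1 : g (R / 2) - g (-(R / 2)) ≤ 2 * K := by simp only [hg_def]; linarith [ha'.2, hb'.1]
  linarith [(by ring : M₁ / 2 * (R / 2 - -(R / 2)) = M₁ / 2 * R)]

end MaxPrinciple

/-! ## The vorticity coordinates of the KNSS §4 representative are in the class of Lemma 2.1 -/
section Vorticity

variable {U : ℝ → EuclideanSpace ℝ (Fin 3) → EuclideanSpace ℝ (Fin 3)}
  {b : ℝ → EuclideanSpace ℝ (Fin 3)}

/-- **A linear function `f = Λ'(curl U)` of the vorticity of the §4 representative which kills the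
stretching (`Λ'(DU[ω]) = 0`) is in the elementary class of Lemma 2.1 with drift `U + b`**:
`f = (Λ' ∘ curlCLM) ∘ DU` is smooth with `|f| ≤ ‖Λ‖C₁`, `‖Df‖ ≤ ‖Λ‖C₂`, `|Δf| ≤ 3‖Λ‖C₃`;
`Df = Λ ∘ D²U`, `Δf = Λ(Σᵢ D²(DU)[eᵢ, eᵢ])` are jointly continuous (time-Lipschitz bounds of
orders `2, 3`); projecting the integrated vorticity equation by `Λ'` gives the equation. [cite: KochNadirashviliSereginSverak2009, §4 (arXiv p. 8) and proof of Thm 5.1 (p. 9)] -/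
theorem lemma21_data (hsm : ∀ t < 0, ContDiff ℝ ∞ (U t)) {C : ℕ → ℝ}
    (hC : ∀ k : ℕ, ∀ t < 0, ∀ x, ‖iteratedFDeriv ℝ k (U t) x‖ ≤ C k) {L : ℕ → ℝ}
    (hL : ∀ k : ℕ, 1 ≤ k → ∀ s < 0, ∀ t < 0, ∀ x,
      ‖iteratedFDeriv ℝ k (U t) x - iteratedFDeriv ℝ k (U s) x‖ ≤ L k * |t - s|)
    (hUm : Measurable (uncurry U)) (hbm : Measurable b) {Cb : ℝ} (hCb : ∀ t, ‖b t‖ ≤ Cb)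
    (hvort : ∀ x, ∀ s t : ℝ, s ≤ t → t < 0 →
      curl (U t) x - curl (U s) x =
        ∫ τ in s..t, ((Δ (curl (U τ))) x - fderiv ℝ (curl (U τ)) x (U τ x + b τ) +
          fderiv ℝ (U τ) x (curl (U τ) x)))
    (Λ' : EuclideanSpace ℝ (Fin 3) →L[ℝ] ℝ)
    (hstr : ∀ τ < 0, ∀ x, Λ' (fderiv ℝ (U τ) x (curl (U τ) x)) = 0) :
    Measurable (uncurry fun t y => U t y + b t) ∧
    (∃ A : ℝ, ∀ t < 0, ∀ y, ‖U t y + b t‖ ≤ A) ∧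
    (∃ C' : ℝ, ∀ t < 0, ∀ y, |Λ' (curl (U t) y)| ≤ C') ∧
    (∀ t < 0, ContDiff ℝ 2 fun y => Λ' (curl (U t) y)) ∧
    (∃ C' : ℝ, ∀ t < 0, ∀ y, ‖fderiv ℝ (fun y => Λ' (curl (U t) y)) y‖ ≤ C' ∧
      |(Δ fun y => Λ' (curl (U t) y)) y| ≤ C') ∧
    ContinuousOn (fun p : ℝ × EuclideanSpace ℝ (Fin 3) =>
      fderiv ℝ (fun y => Λ' (curl (U p.1) y)) p.2) (Iio 0 ×ˢ univ) ∧
    ContinuousOn (fun p : ℝ × EuclideanSpace ℝ (Fin 3) =>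
      (Δ fun y => Λ' (curl (U p.1) y)) p.2) (Iio 0 ×ˢ univ) ∧
    ∀ y, ∀ s t : ℝ, s ≤ t → t < 0 →
      Λ' (curl (U t) y) - Λ' (curl (U s) y) =
        ∫ τ in s..t, ((Δ fun y => Λ' (curl (U τ) y)) y -
          fderiv ℝ (fun y => Λ' (curl (U τ) y)) y (U τ y + b τ)) := by
  set Λ : (EuclideanSpace ℝ (Fin 3) →L[ℝ] EuclideanSpace ℝ (Fin 3)) →L[ℝ] ℝ := Λ'.comp curlCLM
    with hΛ
  have hζ : ∀ t, (fun y => Λ' (curl (U t) y)) = Λ ∘ fderiv ℝ (U t) := fun t => rfl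
  have hDU : ∀ t < 0, ContDiff ℝ ∞ (fderiv ℝ (U t)) := fun t ht =>
    (hsm t ht).fderiv_right (m := ∞) le_rfl
  have hDUd : ∀ t < 0, ∀ y, DifferentiableAt ℝ (fderiv ℝ (U t)) y := fun t ht y =>
    ((hDU t ht).differentiable (by simp)) y
  have hDζ : ∀ t < 0, ∀ y, fderiv ℝ (fun y => Λ' (curl (U t) y)) y =
      Λ.comp (fderiv ℝ (fderiv ℝ (U t)) y) := fun t ht y => by
    rw [hζ]; exact (Λ.hasFDerivAt.comp y (hDUd t ht y).hasFDerivAt).fderiv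
  set bs := stdOrthonormalBasis ℝ (EuclideanSpace ℝ (Fin 3)) with hbs
  have hΔζ : ∀ t < 0, ∀ y, (Δ fun y => Λ' (curl (U t) y)) y =
      Λ (∑ i, iteratedFDeriv ℝ 2 (fderiv ℝ (U t)) y ![bs i, bs i]) := fun t ht y => by
    rw [hζ, ((hDU t ht).of_le (by norm_cast)).contDiffAt.laplacian_CLM_comp_left,
      laplacian_eq_iteratedFDeriv_orthonormalBasis _ bs]
    rfl
  -- time-Lipschitz bounds of `DU` and its derivatives ⟹ joint continuity
  have hL' := lipschitz_fderiv_family_of_succ hL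
  have hW : ContinuousOn (fun p : ℝ × EuclideanSpace ℝ (Fin 3) => fderiv ℝ (fderiv ℝ (U p.1)) p.2)
      (Iio 0 ×ˢ univ) :=
    continuousOn_prod_of_lipschitz_time (ψ := fun t y => fderiv ℝ (fderiv ℝ (U t)) y)
      (fun s hs t ht y => by
        rw [norm_sub_eq_norm_iteratedFDeriv_zero_sub, norm_iteratedFDeriv_fderiv_sub]
        exact hL' 1 s hs t ht y)
      (fun t ht => (hDU t ht).continuous_fderiv (by simp))
  have hJ : ContinuousOn (fun p : ℝ × EuclideanSpace ℝ (Fin 3) =>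
      iteratedFDeriv ℝ 2 (fderiv ℝ (U p.1)) p.2) (Iio 0 ×ˢ univ) :=
    continuousOn_prod_of_lipschitz_time (ψ := fun t y => iteratedFDeriv ℝ 2 (fderiv ℝ (U t)) y)
      (hL' 2) (fun t ht => (hDU t ht).continuous_iteratedFDeriv (natCast_le_contDiff_infty 2))
  refine ⟨?_, ⟨C 0 + Cb, fun t ht y => ?_⟩, ⟨‖Λ‖ * C 1, fun t ht y => ?_⟩,
    fun t ht => by rw [hζ]; exact (Λ.contDiff.comp (hDU t ht)).of_le (by norm_cast),
    ⟨max (‖Λ‖ * C 2) (Module.finrank ℝ (EuclideanSpace ℝ (Fin 3)) * (‖Λ‖ * C 3)),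
      fun t ht y => ⟨?_, ?_⟩⟩, ?_, ?_, fun y s t hst ht => ?_⟩
  · -- the drift is measurable …
    exact (show Measurable fun p : ℝ × EuclideanSpace ℝ (Fin 3) => U p.1 p.2 + b p.1 from
      hUm.add (hbm.comp measurable_fst))
  · -- … and bounded
    have h0 := hC 0 t ht y
    rw [norm_iteratedFDeriv_zero] at h0
    exact (norm_add_le _ _).trans (add_le_add h0 (hCb t))
  · -- `|f| ≤ ‖Λ‖ C₁`
    rw [← Real.norm_eq_abs]
    refine (Λ.le_opNorm (fderiv ℝ (U t) y)).trans ?_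
    rw [norm_fderiv_eq_norm_iteratedFDeriv_one]
    exact mul_le_mul_of_nonneg_left (hC 1 t ht y) (norm_nonneg Λ)
  · -- `‖Df‖ ≤ ‖Λ‖ C₂`
    rw [norm_fderiv_eq_norm_iteratedFDeriv_one, hζ]
    exact ((norm_iteratedFDeriv_clm_apply_fderiv_le Λ (hsm t ht) 1 y).trans
      (mul_le_mul_of_nonneg_left (hC 2 t ht y) (norm_nonneg Λ))).trans (le_max_left _ _)
  · -- `|Δf| ≤ 3 ‖Λ‖ C₃`
    refine ((abs_laplacian_le_finrank_mul _ y).trans ?_).trans (le_max_right _ _)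
    refine mul_le_mul_of_nonneg_left ?_ (Nat.cast_nonneg _)
    rw [hζ]
    exact (norm_iteratedFDeriv_clm_apply_fderiv_le Λ (hsm t ht) 2 y).trans
      (mul_le_mul_of_nonneg_left (hC 3 t ht y) (norm_nonneg Λ))
  · -- `Df` jointly continuous
    exact (continuousOn_const.clm_comp hW).congr fun p hp => hDζ p.1 hp.1 p.2
  · -- `Δf` jointly continuous
    have hc : ContinuousOn (fun p : ℝ × EuclideanSpace ℝ (Fin 3) =>
        Λ (∑ i, iteratedFDeriv ℝ 2 (fderiv ℝ (U p.1)) p.2 ![bs i, bs i])) (Iio 0 ×ˢ univ) :=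
      Λ.continuous.comp_continuousOn (continuousOn_finsetSum _ fun i _ =>
        (ContinuousMultilinearMap.apply ℝ (fun _ : Fin 2 => EuclideanSpace ℝ (Fin 3))
          (EuclideanSpace ℝ (Fin 3) →L[ℝ] EuclideanSpace ℝ (Fin 3))
          ![bs i, bs i]).continuous.comp_continuousOn hJ)
    exact hc.congr fun p hp => hΔζ p.1 hp.1 p.2
  · -- the equation: project the integrated vorticity equation by `Λ'`
    have hs : s < 0 := lt_of_le_of_lt hst ht
    have hint := vorticity_integrand_intervalIntegrable hsm hC hL hUm hbm hCb y hst ht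
    have hproj := congrArg Λ' (hvort y s t hst ht)
    rw [map_sub, ← ContinuousLinearMap.intervalIntegral_comp_comm Λ' hint] at hproj
    refine hproj.trans (intervalIntegral.integral_congr fun τ hτ => ?_)
    have hτ0 : τ < 0 := by
      rw [uIcc_of_le hst] at hτ; exact lt_of_le_of_lt hτ.2 ht
    have hω : ContDiff ℝ 2 (curl (U τ)) := contDiff_curl (n := 2) ((hsm τ hτ0).of_le (by norm_cast))
    have e1 : (Δ fun y => Λ' (curl (U τ) y)) y = Λ' ((Δ (curl (U τ))) y) :=
      hω.contDiffAt.laplacian_CLM_comp_left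
    have e2 := fderiv_clm_comp_left_apply ((hω.differentiable (by norm_num)) y) Λ' (U τ y + b τ)
    show Λ' _ = _
    rw [map_add, map_sub, hstr τ hτ0 y, add_zero, e1, e2]

end Vorticity

/-- **Liouville for bounded ancient `2½`-dimensional flows** (LEAF of disjunct (B) of the hull,
direction `e₁`): a bounded ancient mild solution (`ν = 1`, duality form), classical on `(−∞, 0)`,
with velocity invariant under `x ↦ x + δe₁` at every `t < 0`, is constant on every slice. The
planar trace is constant by KNSS Thm 5.1 (`planarTrace_of_lineInvariant`,
`KNSS2009_liouville_planar_holds`); for the §4 representative `U`, `∂₁U = 0` and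
`(DU h)₀ = (DU h)₂ = 0` at a.e. hence every `t < 0`, so `curl U = (−∂₂U₁, 0, ∂₀U₁)` has no
stretching and vanishes by Lemma 2.1 (`lemma21_data`, `nonpos_of_eq_fderiv_apply` for `±ω₀`,
`±ω₂`); then `U(t)` is constant (`eq_of_curl_eq_zero_of_isDivFree_of_bounded`), and so is
`v(t) = U(t) + b(t)`, at a.e. and then every `t < 0`. [cite: KochNadirashviliSereginSverak2009, Thm 5.1 (arXiv p. 9), §4 (p. 8), Lemma 2.1 (p. 5)] -/
theorem stub_fullTranslationLeaf :
    ∀ (v : ℝ → (EuclideanSpace ℝ (Fin 3)) → (EuclideanSpace ℝ (Fin 3)))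
      (q : ℝ → (EuclideanSpace ℝ (Fin 3)) → ℝ),
      IsBoundedAncientMildSolution 1 v → IsClassicalNSSolutionOn (Set.Iio 0) 1 0 v q →
        (∀ t < 0, ∀ (x : EuclideanSpace ℝ (Fin 3)) (δ : ℝ),
            v t (x + EuclideanSpace.single 1 δ) = v t x) →
          ∀ t < 0, ∃ b : EuclideanSpace ℝ (Fin 3), v t = fun _ => b := by
  intro v q hanc hcl hinv
  have hcont : ContinuousOn (uncurry v) (Iio 0 ×ˢ univ) := hcl.smooth_velocity.continuousOn
  have hVs : ∀ t < 0, ContDiff ℝ ∞ (v t) := fun t ht => hcl.contDiff_velocity ht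
  have hVd : ∀ t < 0, Differentiable ℝ (v t) := fun t ht => (hVs t ht).differentiable (by simp)
  -- (1) `v` is a bounded weak solution on `ℝ³ × (−∞, 0)`; its planar trace is `β(t)`
  have hweak := hanc.isBoundedWeakNSSolutionOn one_pos
    (hcont.aestronglyMeasurable (measurableSet_Iio.prod MeasurableSet.univ))
    fun t ht => (hVs t ht).continuous.aestronglyMeasurable
  obtain ⟨β, -, -, hβ⟩ := KNSS2009_liouville_planar_holds (hweak.planarTrace_of_lineInvariant hcont
    (fun t ht => hinv t ht) fun t ht => hanc.1.1 t ht)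
  have hpl : ∀ t < 0, ∀ x, v t x 0 = v t 0 0 ∧ v t x 2 = v t 0 2 :=
    planar_const_of_ae_const hcont hinv hβ
  -- (2) the regular representative of KNSS §4; good times: `v t = U t + b t` everywhere
  obtain ⟨U, b, hbm, ⟨Cb, hCb⟩, hUm, hae, hsm, hdf, hbd, hlip, hvort⟩ :=
    KNSS2009_regularity_boundedWeak_ancient_holds hweak
  choose C hC using hbd
  choose! L hL using hlip
  have hUd : ∀ t < 0, Differentiable ℝ (U t) := fun t ht => (hsm t ht).differentiable (by simp)
  have hU0 : ∀ t < 0, ∀ x, ‖U t x‖ ≤ C 0 := fun t ht x => by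
    simpa [norm_iteratedFDeriv_zero] using hC 0 t ht x
  have hgood : ∀ᵐ t ∂((volume : Measure ℝ).restrict (Iio 0)), t < 0 ∧ ∀ x, v t x = U t x + b t := by
    filter_upwards [ae_restrict_mem measurableSet_Iio, hae] with t ht h
    exact ⟨ht, fun x => congrFun ((Continuous.ae_eq_iff_eq volume (hVs t ht).continuous
      ((hsm t ht).continuous.add continuous_const)).1 h) x⟩
  -- `∂₁U = 0` and `(DU h)₀ = (DU h)₂ = 0` at good times …
  have hsmul : ∀ s : ℝ, s • EuclideanSpace.single (1 : Fin 3) (1 : ℝ) = EuclideanSpace.single 1 s :=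
    fun s => by ext i; by_cases hi : i = 1 <;> [subst hi; skip] <;> simp [*]
  have hgoodD : ∀ᵐ t ∂((volume : Measure ℝ).restrict (Iio 0)), ∀ x,
      fderiv ℝ (U t) x (EuclideanSpace.single 1 1) = 0 ∧
        ∀ h, fderiv ℝ (U t) x h 0 = 0 ∧ fderiv ℝ (U t) x h 2 = 0 := by
    filter_upwards [hgood] with t ht x
    obtain ⟨ht0, hvU⟩ := ht
    have hU : U t = fun y => v t y - b t := funext fun y => by rw [hvU y, add_sub_cancel_right]
    have hDU : fderiv ℝ (U t) x = fderiv ℝ (v t) x := by rw [hU, fderiv_sub_const]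
    have hcoord : ∀ i : Fin 3, (∀ y, v t y i = v t 0 i) → ∀ h, fderiv ℝ (v t) x h i = 0 := by
      intro i hi h
      have e := fderiv_clm_comp_left_apply (hVd t ht0 x)
        (EuclideanSpace.proj i : EuclideanSpace ℝ (Fin 3) →L[ℝ] ℝ) h
      rw [show (fun y => (EuclideanSpace.proj i : EuclideanSpace ℝ (Fin 3) →L[ℝ] ℝ) (v t y)) =
        fun _ => v t 0 i from funext fun y => hi y, fderiv_fun_const, Pi.zero_apply] at e
      exact e.symm
    rw [hDU]
    refine ⟨?_, fun h => ⟨hcoord 0 (fun y => (hpl t ht0 y).1) h, hcoord 2 (fun y => (hpl t ht0 y).2) h⟩⟩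
    rw [← (hVd t ht0 x).lineDeriv_eq_fderiv, lineDeriv]
    rw [show (fun s : ℝ => v t (x + s • EuclideanSpace.single 1 1)) = fun _ => v t x from
      funext fun s => by rw [hsmul]; exact hinv t ht0 x s, deriv_const]
  -- … hence at every `t < 0`, by continuity in `t`
  have hDc : ∀ x h, ContinuousOn (fun τ => fderiv ℝ (U τ) x h) (Iio 0) := fun x h =>
    (continuousOn_vorticity_data hsm hL x).1.clm_apply continuousOn_const
  have hZ1 : ∀ t < 0, ∀ x, fderiv ℝ (U t) x (EuclideanSpace.single 1 1) = 0 := fun t ht x =>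
    eq_of_ae_restrict_Iio_of_continuousOn (hDc x _) (hgoodD.mono fun s hs => (hs x).1) ht
  have hZ : ∀ i : Fin 3, (i = 0 ∨ i = 2) → ∀ t < 0, ∀ x h, fderiv ℝ (U t) x h i = 0 :=
    fun i hi t ht x h => eq_of_ae_restrict_Iio_of_continuousOn
      ((EuclideanSpace.proj i).continuous.comp_continuousOn (hDc x h))
      (hgoodD.mono fun s hs => by
        rcases hi with rfl | rfl
        exacts [((hs x).2 h).1, ((hs x).2 h).2]) ht
  -- (3) `ω = (−∂₂U₁, 0, ∂₀U₁)`: no stretching, and `±ω₀`, `±ω₂` are `≤ 0` by Lemma 2.1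
  have hG : ∀ t < 0, Differentiable ℝ (fun x => U t x 1) ∧ ∀ x, |U t x 1| ≤ C 0 := fun t ht =>
    ⟨by
      rw [show (fun x => U t x 1) =
        (EuclideanSpace.proj (1 : Fin 3) : EuclideanSpace ℝ (Fin 3) →L[ℝ] ℝ) ∘ U t from rfl]
      exact (EuclideanSpace.proj (1 : Fin 3)).differentiable.comp (hUd t ht), fun x =>
      le_trans (by simpa using PiLp.norm_apply_le (U t x) 1) (hU0 t ht x)⟩
  have hD1 : ∀ t < 0, ∀ x w, fderiv ℝ (fun y => U t y 1) x w = fderiv ℝ (U t) x w 1 :=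
    fun t ht x w => fderiv_clm_comp_left_apply (hUd t ht x)
      (EuclideanSpace.proj (1 : Fin 3) : EuclideanSpace ℝ (Fin 3) →L[ℝ] ℝ) w
  have hω2 : ∀ t < 0, ∀ x,
      curl (U t) x 2 = fderiv ℝ (fun y => U t y 1) x (EuclideanSpace.single 0 1) := fun t ht x => by
    show fderiv ℝ (U t) x (EuclideanSpace.single 0 1) 1 - fderiv ℝ (U t) x (EuclideanSpace.single 1 1) 0 = _
    rw [hD1 t ht, hZ1 t ht x, PiLp.zero_apply, sub_zero]
  have hω0 : ∀ t < 0, ∀ x,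
      curl (U t) x 0 = -fderiv ℝ (fun y => U t y 1) x (EuclideanSpace.single 2 1) := fun t ht x => by
    show fderiv ℝ (U t) x (EuclideanSpace.single 1 1) 2 - fderiv ℝ (U t) x (EuclideanSpace.single 2 1) 1 = _
    rw [hD1 t ht, hZ1 t ht x, PiLp.zero_apply, zero_sub]
  have hP : ∀ i : Fin 3, (i = 0 ∨ i = 2) → ∀ σ : ℝ, ∀ τ < 0, ∀ x,
      (σ • (EuclideanSpace.proj i : EuclideanSpace ℝ (Fin 3) →L[ℝ] ℝ))
        (fderiv ℝ (U τ) x (curl (U τ) x)) = 0 := fun i hi σ τ hτ x => by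
    show σ • (fderiv ℝ (U τ) x (curl (U τ) x) i) = 0
    rw [hZ i hi τ hτ x, smul_zero]
  have key : ∀ i : Fin 3, ∀ hi : i = 0 ∨ i = 2, ∀ σ : ℝ, ∀ e : EuclideanSpace ℝ (Fin 3), ‖e‖ = 1 →
      (∀ t < 0, ∀ x, σ * curl (U t) x i = fderiv ℝ (fun y => σ * U t y 1) x e) → |σ| = 1 →
      ∀ t < 0, ∀ x, σ * curl (U t) x i ≤ 0 := fun i hi σ e he hrep hσ =>
    nonpos_of_eq_fderiv_apply KNSS2009_lemma21_halfball_holds (K := C 0) he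
      (lemma21_data hsm hC hL hUm hbm hCb hvort (σ • EuclideanSpace.proj i) (hP i hi σ))
      fun t ht => ⟨fun y => σ * U t y 1, (hG t ht).1.const_mul σ, fun x => by
        rw [abs_mul, hσ, one_mul]; exact (hG t ht).2 x, hrep t ht⟩
  have hsm' : ∀ t < 0, ∀ σ : ℝ, ∀ x e, fderiv ℝ (fun y => σ * U t y 1) x e =
      σ * fderiv ℝ (fun y => U t y 1) x e := fun t ht σ x e => by
    rw [fderiv_const_mul ((hG t ht).1 x)]; rfl
  have A := key 2 (Or.inr rfl) 1 (EuclideanSpace.single 0 1) (by simp)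
    (fun t ht x => by rw [hsm' t ht, hω2 t ht]) (by simp)
  have B := key 2 (Or.inr rfl) (-1) (EuclideanSpace.single 0 1) (by simp)
    (fun t ht x => by rw [hsm' t ht, hω2 t ht]) (by simp)
  have A' := key 0 (Or.inl rfl) (-1) (-EuclideanSpace.single 2 1) (by simp)
    (fun t ht x => by rw [hsm' t ht, hω0 t ht, map_neg]) (by simp)
  have B' := key 0 (Or.inl rfl) 1 (-EuclideanSpace.single 2 1) (by simp)
    (fun t ht x => by rw [hsm' t ht, hω0 t ht, map_neg]) (by simp)
  have hcurl : ∀ t < 0, ∀ x, curl (U t) x = 0 := fun t ht x => by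
    ext i
    fin_cases i
    · exact le_antisymm (by simpa using B' t ht x) (by simpa using A' t ht x)
    · show fderiv ℝ (U t) x (EuclideanSpace.single 2 1) 0 - fderiv ℝ (U t) x (EuclideanSpace.single 0 1) 2 = 0
      rw [hZ 0 (Or.inl rfl) t ht, hZ 2 (Or.inr rfl) t ht, sub_zero]
    · exact le_antisymm (by simpa using A t ht x) (by simpa using B t ht x)
  -- (4) `U(t)` is constant; `v(t) = v(t, 0)` at good times, hence at every time
  have hUc : ∀ t < 0, ∀ x, U t x = U t 0 := fun t ht x =>
    eq_of_curl_eq_zero_of_isDivFree_of_bounded ((hsm t ht).of_le (by norm_cast)) (hcurl t ht)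
      (hdf t ht) (hU0 t ht) x 0
  intro t ht
  refine ⟨v t 0, funext fun x => sub_eq_zero.1 (eq_of_ae_restrict_Iio_of_continuousOn
    (g := fun s => v s x - v s 0) (c := 0) ?_
    (hgood.mono fun s hs => by simp only [hs.2 x, hs.2 0, hUc s hs.1 x, sub_self]) ht)⟩
  have h1 : ∀ y, ContinuousOn (fun s : ℝ => v s y) (Iio 0) := fun y => by
    have hc : Continuous fun s : ℝ => ((s, y) : ℝ × EuclideanSpace ℝ (Fin 3)) := by fun_prop
    exact hcont.comp hc.continuousOn fun s hs => ⟨hs, mem_univ _⟩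
  exact (h1 x).sub (h1 0)

end Summit.NavierStokesRegularity.NavierStokesRegularity.Theorems.IsobaricLinesLiouville.FluxSurfacePersistence

end
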